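import Summits.CriticalPhenomena.PercolationContinuityZ3.Theorems.PercNearOneGluingNoHeavyQuantSliceSingleLowBudget
import Summits.CriticalPhenomena.PercolationContinuityZ3.Theorems.PercNearOneGluingNoHeavyQuantSliceSingleLowParts
import HarnessLib

/-!
# QUANT lane R8, T-DEC: SL-λ* for ANY NUMBER OF DEEP LOWS — the budget (LEAD-NOTES-G23 N49, Theorem A, arithmetic half)

builds on p205010 (kernel theorem, internal audit signed; external expert review pending)

Support file (`--supports stmt-CriticalPhenomena-4575`), QUANT lane lead seat prim-quant-lead (gen 23), rung R8 of
`run/shared/lean/prim/quant/LADDER.md`.  Five small definitions (the anti-diagonal amounts of the routing and its scaling factor) and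
theorems; standard axioms, no sorries.  Continues the typer's `…QuantSliceSingleLowBudget` (`usage_antiDiag_le`, `singleLow_giant_budget`:
ONE deep low) and `…QuantSliceSingleLowParts` (`band_usage_le`, `sum_giantParts`), and lead g22's N48 single-low blueprint.

THEOREM A (lead g23, N49).  Law `ν ≥ 0` on `{0..M}`, target `T`, floor `0 < x < 1`, blob `(a, g)` with `x ≤ g ≤ 1` AND `1/2 ≤ g`, raised
target `T′ = T + a·g`, layers `j′` and `λ ≤ j′`.  SUPPORT: every charged atom `k ≤ j′` with `2k < T` is a DEEP low (`2(k+a) < T′`,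
`k + a ≤ j′`); every charged non-low atom `k ≤ λ` has `2k ≤ T′` (band-like); every charged atom in `(λ, j′]` has `2k > T′` (true window mid)
— any number of each, plus any giants `> j′`.  HYPOTHESES: flow witnesses `f⁰` of DEC at `(T, j′)` and `f^λ` of DEC at `(T, λ)`
(`IsFlowAtT`).  CONCLUSION (`…QuantSliceDeepLows`): `FlowAtT x T′ j′ (M+a) (slice ν a g)`.  With `λ = λ*` (= least true window mid − 1) the
support conditions on band atoms / window mids are automatic (N48 (1)); the theorem REPLACES the Case 1 / Case 2 split of the single-low
blueprint by one scaling factor per low and covers every number of deep lows and window mids at once.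

THE ROUTING.  `u = x/(1−x)`; for a deep low `l` and a mid `m ≤ j′` of `f⁰`: `u⁰ = usage x T j′ l m`, `u_ad = usage x T′ j′ (l+a) m ≤ u⁰`.
(i) band verticals `w ↦ w + a` carry `(1−g)ν_w` (self-financing, `band_usage_le`); (ii) the row-1 copy `l + a` of each deep low ships the
ANTI-DIAGONAL amounts `dlAd l m = σ_l · (1−g)·f⁰(l,m)·u⁰/u_ad` into the row-0 copies of `f⁰`'s mids, where `σ_l = min(1, g·ν_l / Σ_m (1−g)f⁰(l,m)u⁰/u_ad)`
(`dlScale`) keeps the total within the mass `g·ν_l` of the copy; the load on `m` is `Σ_l σ_l(1−g)u⁰f⁰(l,m) ≤ (1−g)ν_m` (`antiDiag_load_le`);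
(iii) everything else — `dlRest l = ν_l − Σ_m dlAd l m` per low, both copies together — rides the GIANT POOL of the slice (row-0 and row-1
copies of the atoms `> j′`, row-1 copies of the atoms `> λ`), of mass `Π = (1−g)·ν(>j′) + g·ν(>λ)` (`sum_giantParts`).
KEY STEP (`sum_dlAd_ge`): `Σ_m dlAd l m ≥ (1−g)·Σ_{m ≤ j′} f⁰(l,m)` — termwise if `σ_l = 1` (`u_ad ≤ u⁰`), and `= g·ν_l ≥ (1−g)·ν_l` if `σ_l < 1`
(here `g ≥ 1/2` is used).  POOL INEQUALITY (`pool_budget`): `u·Σ_l dlRest l ≤ Π`, from `g·(H_λ) + (1−g)·(H_j′)`: at layer `λ` a deep low sees only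
giants (band-like atoms are incompatible, `band_deep_incompatible`), so `u·ν(lows) ≤ ν(>λ)` (`pool_of_flow_lam`); at layer `j′`,
`u·ν(lows) ≤ ν(>j′) + u·f⁰(lows, mids)` (`pool_of_flow_top`).

EVIDENCE before the proof: exact routing check prim-quant-lead-g23/explore/g23_thmA.py (198/198 boundary-pushed instances, ≤ 4 deep lows,
≤ 3 window mids, band atoms, giants; LP-concordant).  [this work]; nothing here is cited as a published result.  The gluing rows served
[cite: KozmaNitzan2024, Conjecture 3 (p. 15)]; product measure [cite: Grimmett1999, §1.3 p. 10].
-/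

noncomputable section

namespace Summit.CriticalPhenomena.PercolationContinuityZ3.Theorems

namespace Quant

open Finset

namespace LawDec

/-! ### The anti-diagonal amounts of the routing -/

/-- **unscaled anti-diagonal amount** shipped from the row-1 copy `l + a` of the deep low `l` into the row-0 copy of the mid `m ≤ j′`:
`(1−g)·f⁰(l,m)·u⁰/u_ad` (zero unless `f⁰(l,m) > 0`). [this work] -/
def dlCoef (x T g : ℝ) (j' a : ℕ) (f0 : ℕ → ℕ → ℝ) (l m : ℕ) : ℝ :=
  if m ≤ j' ∧ 0 < f0 l m then
    (1 - g) * f0 l m * usage x T j' l m / usage x (T + (a : ℝ) * g) j' (l + a) m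
  else 0

/-- total unscaled anti-diagonal amount of the low `l`. [this work] -/
def dlCap (x T g : ℝ) (j' a : ℕ) (f0 : ℕ → ℕ → ℝ) (l : ℕ) : ℝ :=
  ∑ m ∈ Finset.range (j' + 1), dlCoef x T g j' a f0 l m

/-- **the scaling factor `σ_l = min(1, g·ν_l / dlCap l)`** (as an `ite`). [this work] -/
def dlScale (x T g : ℝ) (j' a : ℕ) (ν : ℕ → ℝ) (f0 : ℕ → ℕ → ℝ) (l : ℕ) : ℝ :=
  if dlCap x T g j' a f0 l ≤ g * ν l then 1 else g * ν l / dlCap x T g j' a f0 l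

/-- **the anti-diagonal amount `σ_l · dlCoef l m`**. [this work] -/
def dlAd (x T g : ℝ) (j' a : ℕ) (ν : ℕ → ℝ) (f0 : ℕ → ℕ → ℝ) (l m : ℕ) : ℝ :=
  dlScale x T g j' a ν f0 l * dlCoef x T g j' a f0 l m

/-- **the pool-bound mass of the low `l`** (both copies together): `ν_l − Σ_m dlAd l m`. [this work] -/
def dlRest (x T g : ℝ) (j' a : ℕ) (ν : ℕ → ℝ) (f0 : ℕ → ℕ → ℝ) (l : ℕ) : ℝ :=
  ν l - ∑ m ∈ Finset.range (j' + 1), dlAd x T g j' a ν f0 l m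

/-! ### Elementary bounds -/

section Budget

variable (x T g : ℝ) (j' M a : ℕ) (ν : ℕ → ℝ) (f0 : ℕ → ℕ → ℝ)

/-- `dlCoef ≥ 0` once the two usages at a charged pair are positive. -/
theorem dlCoef_nonneg (hg1 : g ≤ 1)
    (hpos : ∀ l m, m ≤ j' → 0 < f0 l m → 0 < usage x T j' l m ∧ 0 < usage x (T + (a : ℝ) * g) j' (l + a) m) (l m : ℕ) :
    0 ≤ dlCoef x T g j' a f0 l m := by
  unfold dlCoef
  split_ifs with h
  · obtain ⟨hu0, hu1⟩ := hpos l m h.1 h.2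
    exact div_nonneg (mul_nonneg (mul_nonneg (by linarith) h.2.le) hu0.le) hu1.le
  · exact le_rfl

/-- `dlCap ≥ 0`. -/
theorem dlCap_nonneg (hg1 : g ≤ 1)
    (hpos : ∀ l m, m ≤ j' → 0 < f0 l m → 0 < usage x T j' l m ∧ 0 < usage x (T + (a : ℝ) * g) j' (l + a) m) (l : ℕ) :
    0 ≤ dlCap x T g j' a f0 l :=
  Finset.sum_nonneg fun m _ => dlCoef_nonneg x T g j' a f0 hg1 hpos l m

/-- `0 ≤ σ_l ≤ 1`. -/
theorem dlScale_nonneg_le_one (hg0 : 0 ≤ g) (hν : ∀ k, 0 ≤ ν k) (l : ℕ) :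
    0 ≤ dlScale x T g j' a ν f0 l ∧ dlScale x T g j' a ν f0 l ≤ 1 := by
  unfold dlScale
  split_ifs with h
  · exact ⟨zero_le_one, le_rfl⟩
  · have hcap : g * ν l < dlCap x T g j' a f0 l := not_le.1 h
    have hgν : 0 ≤ g * ν l := mul_nonneg hg0 (hν l)
    have hcpos : 0 < dlCap x T g j' a f0 l := lt_of_le_of_lt hgν hcap
    exact ⟨div_nonneg hgν hcpos.le, (div_le_one hcpos).2 hcap.le⟩

/-- `0 ≤ dlAd ≤ dlCoef`. -/
theorem dlAd_nonneg_le (hg0 : 0 ≤ g) (hg1 : g ≤ 1) (hν : ∀ k, 0 ≤ ν k)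
    (hpos : ∀ l m, m ≤ j' → 0 < f0 l m → 0 < usage x T j' l m ∧ 0 < usage x (T + (a : ℝ) * g) j' (l + a) m) (l m : ℕ) :
    0 ≤ dlAd x T g j' a ν f0 l m ∧ dlAd x T g j' a ν f0 l m ≤ dlCoef x T g j' a f0 l m := by
  obtain ⟨hs0, hs1⟩ := dlScale_nonneg_le_one x T g j' a ν f0 hg0 hν l
  have hc := dlCoef_nonneg x T g j' a f0 hg1 hpos l m
  unfold dlAd
  exact ⟨mul_nonneg hs0 hc, by nlinarith⟩

/-- `dlAd l m = 0` unless `m ≤ j′` and `f⁰(l,m) > 0`. -/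
theorem dlAd_eq_zero (l m : ℕ) (h : ¬ (m ≤ j' ∧ 0 < f0 l m)) : dlAd x T g j' a ν f0 l m = 0 := by
  unfold dlAd dlCoef
  rw [if_neg h, mul_zero]

/-- **the anti-diagonals fit into the row-1 copy**: `Σ_m dlAd l m ≤ g·ν_l`. [this work] -/
theorem sum_dlAd_le (hg0 : 0 ≤ g) (hν : ∀ k, 0 ≤ ν k) (l : ℕ) :
    ∑ m ∈ Finset.range (j' + 1), dlAd x T g j' a ν f0 l m ≤ g * ν l := by
  have e : ∑ m ∈ Finset.range (j' + 1), dlAd x T g j' a ν f0 l m = dlScale x T g j' a ν f0 l * dlCap x T g j' a f0 l := by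
    unfold dlAd dlCap; rw [Finset.mul_sum]
  rw [e]
  unfold dlScale
  split_ifs with h
  · rw [one_mul]; exact h
  · have hcap : g * ν l < dlCap x T g j' a f0 l := not_le.1 h
    have hcpos : 0 < dlCap x T g j' a f0 l := lt_of_le_of_lt (mul_nonneg hg0 (hν l)) hcap
    rw [div_mul_cancel₀ _ hcpos.ne']

/-- the usage consumed by one anti-diagonal: `u_ad · dlAd l m = σ_l·(1−g)·u⁰·f⁰(l,m)·[m ≤ j′]`. -/
theorem usage_mul_dlAd (hf00 : ∀ l m, 0 ≤ f0 l m)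
    (hpos : ∀ l m, m ≤ j' → 0 < f0 l m → 0 < usage x T j' l m ∧ 0 < usage x (T + (a : ℝ) * g) j' (l + a) m)
    (l m : ℕ) :
    usage x (T + (a : ℝ) * g) j' (l + a) m * dlAd x T g j' a ν f0 l m
      = dlScale x T g j' a ν f0 l * ((1 - g) * (usage x T j' l m * (if m ≤ j' then f0 l m else 0))) := by
  unfold dlAd dlCoef
  by_cases h : m ≤ j' ∧ 0 < f0 l m
  · rw [if_pos h, if_pos h.1]
    have hu := (hpos l m h.1 h.2).2
    field_simp
  · rw [if_neg h, mul_zero, mul_zero]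
    by_cases hm : m ≤ j'
    · have hz : f0 l m = 0 := le_antisymm (not_lt.1 (fun hp => h ⟨hm, hp⟩)) (hf00 l m)
      rw [if_pos hm, hz]; ring
    · rw [if_neg hm]; ring


/-! ### Geometry of a charged pair of `f⁰` under the support hypotheses -/

/-- **a charged pair `(l, m)` of `f⁰` with `m ≤ j′`**: `l` is a deep low, `m` a compatible true window mid above `l + a`, and both the
original and the anti-diagonal usage are positive. [this work] -/
theorem dl_geom (hx0 : 0 < x) (hx1 : x < 1) (hg1 : g ≤ 1) (hf0 : IsFlowAtT x T j' M ν f0)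
    (hdeep : ∀ k, k ≤ j' → 2 * (k : ℝ) < T → ν k ≠ 0 → 2 * ((k : ℝ) + a) < T + (a : ℝ) * g ∧ k + a ≤ j')
    (l m : ℕ) (hmj : m ≤ j') (hflm : 0 < f0 l m) :
    l ≤ j' ∧ 2 * (l : ℝ) < T ∧ m ≤ M ∧ T < (l : ℝ) + m ∧ 2 * ((l : ℝ) + a) < T + (a : ℝ) * g ∧ l + a < m ∧
      0 < usage x T j' l m ∧ 0 < usage x (T + (a : ℝ) * g) j' (l + a) m := by
  obtain ⟨hl, hlow, hmM, hc⟩ := hf0.2.1 l m hflm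
  have hcomp : T < (l : ℝ) + m := by
    rcases hc with hc | hc
    · omega
    · exact hc
  have hνl : 0 < ν l := by
    rw [← hf0.2.2.1 l hl hlow]
    exact lt_of_lt_of_le hflm (Finset.single_le_sum (fun h _ => hf0.1 l h) (Finset.mem_range.2 (by omega)))
  have hd := (hdeep l hl hlow hνl.ne').1
  have hmid := deep_straddler_two_mul_gt T g l m a hg1 hd hcomp
  have hlam : l + a < m := deep_lt_mid T g l m a hd hmid.le
  have hlm : l < m := by omega
  have hu0 := usage_pos_of_compat x T j' l m hx0 hx1 hlow hlm (Or.inr hcomp)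
  have hlow' : 2 * (((l + a : ℕ) : ℝ)) < T + (a : ℝ) * g := by push_cast; exact hd
  have hu1 := usage_pos_of_compat x (T + (a : ℝ) * g) j' (l + a) m hx0 hx1 hlow' hlam
    (Or.inr (antiDiag_compatible T g l m a hg1 hcomp))
  exact ⟨hl, hlow, hmM, hcomp, hd, hlam, hu0, hu1⟩

/-- the positivity side condition of the budget lemmas, discharged. -/
theorem dl_pos (hx0 : 0 < x) (hx1 : x < 1) (hg1 : g ≤ 1) (hf0 : IsFlowAtT x T j' M ν f0)
    (hdeep : ∀ k, k ≤ j' → 2 * (k : ℝ) < T → ν k ≠ 0 → 2 * ((k : ℝ) + a) < T + (a : ℝ) * g ∧ k + a ≤ j') :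
    ∀ l m, m ≤ j' → 0 < f0 l m → 0 < usage x T j' l m ∧ 0 < usage x (T + (a : ℝ) * g) j' (l + a) m := by
  intro l m hmj hflm
  obtain ⟨-, -, -, -, -, -, hu0, hu1⟩ := dl_geom x T g j' M a ν f0 hx0 hx1 hg1 hf0 hdeep l m hmj hflm
  exact ⟨hu0, hu1⟩

/-- a low ships at most its mass into the atoms `≤ j′`: `Σ_{m ≤ j′} f⁰(l,m) ≤ ν_l`. -/
theorem sum_top_le_mass (hf0 : IsFlowAtT x T j' M ν f0) (l : ℕ) (hl : l ≤ j') (hlow : 2 * (l : ℝ) < T) :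
    ∑ m ∈ Finset.range (j' + 1), f0 l m ≤ ν l := by
  rw [← hf0.2.2.1 l hl hlow]
  have e : ∑ m ∈ Finset.range (j' + 1), f0 l m = ∑ m ∈ (Finset.range (j' + 1)).filter (fun m => m ≤ M), f0 l m := by
    rw [Finset.sum_filter_of_ne]
    intro m _ hne
    by_contra hgt
    have hpos : 0 < f0 l m := lt_of_le_of_ne (hf0.1 l m) (Ne.symm hne)
    exact hgt (hf0.2.1 l m hpos).2.2.1
  rw [e]
  refine Finset.sum_le_sum_of_subset_of_nonneg ?_ (fun m _ _ => hf0.1 l m)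
  intro m hm
  rw [Finset.mem_filter, Finset.mem_range] at hm
  exact Finset.mem_range.2 (by omega)

/-- **KEY STEP**: `(1−g)·Σ_{m ≤ j′} f⁰(l,m) ≤ Σ_m dlAd l m` — termwise when `σ_l = 1` (`u_ad ≤ u⁰`), and through `Σ_m dlAd l m = g·ν_l ≥ (1−g)·ν_l`
when `σ_l < 1`; the only use of `g ≥ 1/2`. [this work] -/
theorem sum_dlAd_ge (hx0 : 0 < x) (hx1 : x < 1) (hg1 : g ≤ 1) (hg2 : 1 / 2 ≤ g) (hν : ∀ k, 0 ≤ ν k)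
    (hf0 : IsFlowAtT x T j' M ν f0)
    (hdeep : ∀ k, k ≤ j' → 2 * (k : ℝ) < T → ν k ≠ 0 → 2 * ((k : ℝ) + a) < T + (a : ℝ) * g ∧ k + a ≤ j')
    (l : ℕ) (hl : l ≤ j') (hlow : 2 * (l : ℝ) < T) :
    (1 - g) * ∑ m ∈ Finset.range (j' + 1), f0 l m ≤ ∑ m ∈ Finset.range (j' + 1), dlAd x T g j' a ν f0 l m := by
  have hpos := dl_pos x T g j' M a ν f0 hx0 hx1 hg1 hf0 hdeep
  by_cases hcase : dlCap x T g j' a f0 l ≤ g * ν l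
  · -- σ_l = 1: termwise
    have hs : dlScale x T g j' a ν f0 l = 1 := by unfold dlScale; rw [if_pos hcase]
    rw [Finset.mul_sum]
    refine Finset.sum_le_sum fun m hm => ?_
    have hmj : m ≤ j' := Nat.lt_succ_iff.1 (Finset.mem_range.1 hm)
    unfold dlAd
    rw [hs, one_mul]
    unfold dlCoef
    by_cases hflm : 0 < f0 l m
    · rw [if_pos ⟨hmj, hflm⟩]
      obtain ⟨-, -, -, hcomp, hd, -, hu0, hu1⟩ := dl_geom x T g j' M a ν f0 hx0 hx1 hg1 hf0 hdeep l m hmj hflm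
      have hle := usage_antiDiag_le x T g j' l m a hx0 hx1 hg1 hmj hlow hd hcomp
      rw [le_div_iff₀ hu1]
      have h1g : 0 ≤ (1 - g) * f0 l m := mul_nonneg (by linarith) hflm.le
      calc (1 - g) * f0 l m * usage x (T + (a : ℝ) * g) j' (l + a) m
          ≤ (1 - g) * f0 l m * usage x T j' l m := mul_le_mul_of_nonneg_left hle h1g
        _ = (1 - g) * f0 l m * usage x T j' l m := rfl
    · have hz : f0 l m = 0 := le_antisymm (not_lt.1 hflm) (hf0.1 l m)
      rw [if_neg (fun h => hflm h.2), hz, mul_zero]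
  · -- σ_l < 1: the anti-diagonals carry exactly g·ν_l ≥ (1−g)·ν_l
    have e : ∑ m ∈ Finset.range (j' + 1), dlAd x T g j' a ν f0 l m = g * ν l := by
      have e1 : ∑ m ∈ Finset.range (j' + 1), dlAd x T g j' a ν f0 l m = dlScale x T g j' a ν f0 l * dlCap x T g j' a f0 l := by
        unfold dlAd dlCap; rw [Finset.mul_sum]
      have hcap : g * ν l < dlCap x T g j' a f0 l := not_le.1 hcase
      have hcpos : 0 < dlCap x T g j' a f0 l := lt_of_le_of_lt (mul_nonneg (by linarith) (hν l)) hcap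
      rw [e1]
      unfold dlScale
      rw [if_neg hcase, div_mul_cancel₀ _ hcpos.ne']
    rw [e]
    have hS := sum_top_le_mass x T j' M ν f0 hf0 l hl hlow
    have hS0 : 0 ≤ ∑ m ∈ Finset.range (j' + 1), f0 l m := Finset.sum_nonneg fun m _ => hf0.1 l m
    nlinarith [hν l]

/-- **THE ANTI-DIAGONAL LOAD on a mid position `p`** (`T ≤ 2p`): `Σ_l u_ad(l,p)·dlAd l p ≤ (1−g)·ν_p` (the `f⁰` capacity row at `p`,
scaled by `1−g`, since `σ_l ≤ 1`). [this work] -/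
theorem antiDiag_load_le (hx0 : 0 < x) (hx1 : x < 1) (hg0 : 0 ≤ g) (hg1 : g ≤ 1) (hν : ∀ k, 0 ≤ ν k)
    (hf0 : IsFlowAtT x T j' M ν f0)
    (hdeep : ∀ k, k ≤ j' → 2 * (k : ℝ) < T → ν k ≠ 0 → 2 * ((k : ℝ) + a) < T + (a : ℝ) * g ∧ k + a ≤ j')
    (p : ℕ) (hp2 : T ≤ 2 * (p : ℝ)) :
    ∑ l ∈ Finset.range (j' + 1), usage x (T + (a : ℝ) * g) j' (l + a) p * dlAd x T g j' a ν f0 l p ≤ (1 - g) * ν p := by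
  have hpos := dl_pos x T g j' M a ν f0 hx0 hx1 hg1 hf0 hdeep
  -- termwise: u_ad·dlAd = σ_l(1−g)u⁰f⁰[p ≤ j′] ≤ (1−g)·u⁰f⁰·[p ≤ j′]
  have hterm : ∀ l ∈ Finset.range (j' + 1),
      usage x (T + (a : ℝ) * g) j' (l + a) p * dlAd x T g j' a ν f0 l p
        ≤ (1 - g) * (usage x T j' l p * (if p ≤ j' then f0 l p else 0)) := by
    intro l _
    rw [usage_mul_dlAd x T g j' a ν f0 hf0.1 hpos l p]
    obtain ⟨hs0, hs1⟩ := dlScale_nonneg_le_one x T g j' a ν f0 hg0 hν l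
    have hin : 0 ≤ (1 - g) * (usage x T j' l p * (if p ≤ j' then f0 l p else 0)) := by
      refine mul_nonneg (by linarith) ?_
      split_ifs with hpj
      · rcases (hf0.1 l p).eq_or_lt with hz | hflp
        · rw [← hz, mul_zero]
        · exact (mul_pos (hpos l p hpj hflp).1 hflp).le
      · rw [mul_zero]
    nlinarith
  refine (Finset.sum_le_sum hterm).trans ?_
  rw [← Finset.mul_sum]
  refine mul_le_mul_of_nonneg_left ?_ (by linarith)
  by_cases hpj : p ≤ j'
  · simp only [if_pos hpj]
    by_cases hpM : p ≤ M
    · exact hf0.2.2.2 p hpM (Or.inr hp2)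
    · -- no charged flow above M
      have hz : ∀ l ∈ Finset.range (j' + 1), usage x T j' l p * f0 l p = 0 := by
        intro l _
        rcases (hf0.1 l p).eq_or_lt with hz | hflp
        · rw [← hz, mul_zero]
        · exact absurd (hf0.2.1 l p hflp).2.2.1 hpM
      rw [Finset.sum_eq_zero hz]
      exact hν p
  · simp only [if_neg hpj, mul_zero, Finset.sum_const_zero]
    exact hν p

end Budget

end LawDec

end Quant

end Summit.CriticalPhenomena.PercolationContinuityZ3.Theorems
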